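import Summits.QuantumFields.YangMills.Theses.BalabanUVNodes
import Summits.QuantumFields.YangMills.Theorems.BalabanUVNodesK2EndOfChain190OwnDrift

/-!
# K2⁷ `EndpointGivenBR13SepCoPH` (stmt-QuantumFields-20543) — REV-26 DISPLAY AUDIT, items lens (idea-4 g11): the seam between K1⁷'s ∃θ and
# K2⁷∕K3⁷'s ∀θ is ONE FILTER on the parameter tuples; every display variant on the table is an instance; one `closes` serves them all

Cell ym-nodeO-ideate, seat IDEA-4 (lens «ideate on items»), gen 11.  Sketch ∕ evidence for the plan's drawer D82-REV26 (director-ym №29 PRESS of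
Variant R); NOT a skeleton, registers nothing, no `sorry`, no new axioms.  Companion memo: `Cruxes/EndpointGivenBR13SepCoPH/REV26-PRESS-AUDIT-idea4-g11.md`.

THE POINT.  Write the four ⁷ items over a REGIME FAMILY `𝓛 F : Filter (Node00.Stage13HParams F 2)`:
* `K1L 𝓛` — K1's family ENTERS every `𝓛`-large set: `∃ᶠ θ in 𝓛 F, ∃ hP, unity ∧ slots ∧ admissible ∧ (B) ∧ window` (frequently);
* `K2L 𝓛` — node O owes END only `𝓛`-EVENTUALLY: `∀ᶠ θ in 𝓛 F, ∀ hP, unity ∧ slots → admissible → (B) → window → END`;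
* `K3L 𝓛` — likewise for the spine (K3⁷'s hypotheses verbatim, no window);
* `closesL` — `K0⁷ → K1L 𝓛 → K2L 𝓛 → K3L 𝓛 → BalabanLadder.UV` for EVERY `𝓛` (`Frequently.and_eventually` + `.exists`; five lines).
Then (all kernel-checked below):
* rev 25 (the ⁷ texts as filed)            = the instance `𝓛 := ⊤`            (`k1L_top_iff`, `k2L_top_iff`, `k3L_top_iff`);
* director-ym №29's Variant R («rows as hypothesis of K2, conjunct of K1»), in plan g84's v7 vocabulary = the instance `𝓛 := 𝓟 {rows hold}`
  (`k2L_rows_iff`, `k1L_rows_iff`) — and THERE node O's item is BORN CLOSED (`k2R7_holds`, an4 p606097 §1 by name; `closesR7_cone3`: cone = 3);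
* plan's Variant T («∃ ε⋆ ∀ θ.ε₂₉ ≤ ε⋆»)    = the instance `𝓛 := comap ε₂₉ (𝓝[>] 0)` (`byEps29Uniform`);
* the seam game S′ («other letters frozen, ε₂₉ → 0⁺») = the instance `𝓛 := ⨆ θ₀, map (θ₀[ε₂₉ := ·]) (𝓝[>] 0)` (`byEps29Frozen`, `k2L_byEps29Frozen_iff`), finer than T
  (`byEps29Frozen_le_uniform`);
* print's ORDER OF CONSTANTS ([I] Thm 3 p. 264: «κ ≥ κ₀, M ≥ M(κ), ε₀, ε₁, α's sufficiently small, γ ≤ γ̄(…)») = an iterated `Filter.curry` pushed through a letters-setter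
  (`bySeam2`, `k2L_bySeam2_iff`: «for every frozen class, ∀ᶠ e → 0⁺, ∀ᶠ g → 0⁺, …»; thresholds of later letters may depend on earlier ones).
The dial is monotone (`k2L_of_le`, `k1L_of_le`): a finer regime filter = a weaker node-O item and a stronger K1 item; `⊤` is the node-O-maximal end
(= the g10 finding: K2⁷ ∀θ is Thm 2's END half UNIFORMLY in all of print's chosen constants), `𝓟 {rows}` the K1-maximal end (node O's wall moves
into K1's conjunct and K2 becomes a theorem).  K1's lane naturally proves EVENTUALLY along print's order for its parametric family; `k1L_of_eventually`
turns that into `K1L` whenever the regime filter is proper (`NeBot` — a section through any K0 tuple).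

HONEST FRAMING.  Quantifier bookkeeping over displayed hypothesis shapes; NOTHING of Bałaban's analysis is asserted or discharged; K2⁷ and its
registered stubs are OPEN (v6 of record: 2 registered, 0 closed; v7 PRECUT pending); no item is re-typed by this file (route texts are the plan's ∕
chair's, rev 26 pending); counts UNMOVED; [Balaban1987RG1] Thm 2 + (0.31) p. 259 is UNPROVED IN PRINT; route R4 closes the CONDITIONAL finite-𝕋⁴
rung `BalabanLadder.UV` only — NOT the continuum limit, NOT ℝ⁴, NOT OS reconstruction, NOT the Yang–Mills mass gap, NOT the Clay problem.
-/

namespace Summit.QuantumFields.YangMills.Cruxes.EndpointGivenBR13SepCoPH.Idea4g11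

open Filter Topology
open scoped Filter Topology
open Literature.MathematicalPhysics.QuantumFieldTheory.Balaban1983to89
open Literature.MathematicalPhysics.QuantumFieldTheory.Balaban1983to89.FlowStep
open Literature.MathematicalPhysics.QuantumFieldTheory.Balaban1983to89.B13ScaleTransfer (Pt)
open Literature.MathematicalPhysics.QuantumFieldTheory.Balaban1983to89.DagBinding (EndpointExistence)
open Literature.MathematicalPhysics.QuantumFieldTheory.Balaban1983to89.T4Continuum (T4Family)
open Literature.MathematicalPhysics.QuantumFieldTheory.Balaban1983to89.Beta.Drift (OneLoopDrift)
open Literature.MathematicalPhysics.QuantumFieldTheory.Balaban1983to89.Beta.RemainderChainLattice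
open Literature.MathematicalPhysics.QuantumFieldTheory.Balaban1983to89.Beta.RemainderLimitTorus (LDom limKernel)
open Literature.MathematicalPhysics.QuantumFieldTheory.Balaban1983to89.Beta.RemainderLocalityHolo
open Literature.MathematicalPhysics.QuantumFieldTheory.Balaban1983to89.Beta.RemainderDecay190
open Literature.MathematicalPhysics.QuantumFieldTheory.Balaban1983to89.Beta.RemainderDecay190HoloChain
open Summit.QuantumFields.YangMills.Theorems.BalabanUVNodesK2NamedJetsRunRemAt (SurvCont)
open Summit.QuantumFields.YangMills.Theorems.BalabanUVNodesK2EndOfChain190OwnDrift (endpointExistence_of_runLeaves190H_ownDrift)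
open Summit.QuantumFields.YangMills.Theses.BalabanUVNodes
  (Record13SepCoPHInhabited StabilityBAtRecordR13SepCoPH EndpointGivenBR13SepCoPH SpineGivenEndpointR13SepCoPH)

/-! ## §0 One bookkeeping abbreviation (reducible; nothing new is typed) -/

/-- K0⁷'s body at the family `F` (= the antecedent of K1⁷, verbatim). [cite: Balaban1987RG1, (0.19)–(0.21) p.256 (bookkeeping)] -/
abbrev Inhabited13 (F : T4Family) : Prop :=
  ∃ θ : Node00.Stage13HParams F 2, θ.Provisos₁₃SepCoPH F 2 ∧ (θ.ZhUnity F 2 ∧ θ.SlotsNondegenerate₁₃ F 2) ∧ θ.Admissible F 2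

/-! ## §1 The seam as ONE filter: the ⁷ items over a regime family `𝓛`, one `closes` for all regimes -/

section Seam

variable (𝓛 : (F : T4Family) → Filter (Node00.Stage13HParams F 2))

/-- **K1ᴸ** — K1's family ENTERS every `𝓛`-large set of tuples: frequently along `𝓛 F`, some proviso'd tuple carries unity ∧ slots ∧ admissible ∧ (B) ∧ window
(K1⁷'s consequent verbatim under `∃ᶠ`). [cite: Balaban1989LargeFieldII, Thm 1 + (0.1) pp.355–356; Balaban1988Convergent, (2.10) p.256] -/
def K1L : Prop :=
  ∀ F : T4Family, Inhabited13 F → ∃ᶠ θ in 𝓛 F, ∃ hP : θ.Provisos₁₃SepCoPH F 2,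
    (θ.ZhUnity F 2 ∧ θ.SlotsNondegenerate₁₃ F 2) ∧ θ.Admissible F 2 ∧
    B16.EndStatementBPrinted (Node00.datumOfRecord₁₃SepCoPH F 2 θ hP).C ∧
    ∃ γ₁ : ℝ, 0 < γ₁ ∧ ∀ γ : ℝ, 0 < γ → γ ≤ γ₁ →
      ∃ P : B12.RunParams, 1 ≤ P.K ∧ ((Node00.datumOfRecord₁₃SepCoPH F 2 θ hP).C P).flow.InInterval γ P.K

/-- **K2ᴸ** — node O owes END only `𝓛`-EVENTUALLY: for all tuples far enough along the regime, K2⁷'s body verbatim.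
[cite: Balaban1987RG1, Thm 2 p.259 (first sentence), Thm 3 p.264] -/
def K2L : Prop :=
  ∀ F : T4Family, ∀ᶠ θ in 𝓛 F, ∀ hP : θ.Provisos₁₃SepCoPH F 2,
    (θ.ZhUnity F 2 ∧ θ.SlotsNondegenerate₁₃ F 2) → θ.Admissible F 2 →
    B16.EndStatementBPrinted (Node00.datumOfRecord₁₃SepCoPH F 2 θ hP).C →
    (∃ γ₁ : ℝ, 0 < γ₁ ∧ ∀ γ : ℝ, 0 < γ → γ ≤ γ₁ →
      ∃ P : B12.RunParams, 1 ≤ P.K ∧ ((Node00.datumOfRecord₁₃SepCoPH F 2 θ hP).C P).flow.InInterval γ P.K) →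
    EndpointExistence (Node00.datumOfRecord₁₃SepCoPH F 2 θ hP).C.toB12

/-- **K3ᴸ** — the spine, `𝓛`-eventually (K3⁷'s body verbatim). [cite: Balaban1985UVStability3d, Thm 1 p.18; Balaban1989LargeFieldII, Thm 1 pp.355–356 (bookkeeping)] -/
def K3L : Prop :=
  ∀ F : T4Family, ∀ᶠ θ in 𝓛 F, ∀ hP : θ.Provisos₁₃SepCoPH F 2,
    (θ.ZhUnity F 2 ∧ θ.SlotsNondegenerate₁₃ F 2) → θ.Admissible F 2 →
    B16.EndStatementBPrinted (Node00.datumOfRecord₁₃SepCoPH F 2 θ hP).C →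
    EndpointExistence (Node00.datumOfRecord₁₃SepCoPH F 2 θ hP).C.toB12 →
    T4ApexHybrid.HybridNE7Under (Node00.datumOfRecord₁₃SepCoPH F 2 θ hP)
      (EndpointExistence (Node00.datumOfRecord₁₃SepCoPH F 2 θ hP).C.toB12)

/-- **`closes` FOR EVERY REGIME**: frequently ∧ (eventually ∧ eventually) ⟹ a common tuple ⟹ the rung `BalabanLadder.UV`.  All four binders load-bearing.
[cite: Balaban1987RG1, Thm 2 p.259 (first sentence); Balaban1989LargeFieldII, Thm 1 pp.355–356 (bookkeeping)] -/
theorem closesL (h0 : Record13SepCoPHInhabited) (h1 : K1L 𝓛) (h2 : K2L 𝓛) (h3 : K3L 𝓛) :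
    Summit.QuantumFields.YangMills.Theses.BalabanLadder.UV := by
  intro F
  obtain ⟨θ, ⟨hP, hU, hθ, hb, hwin⟩, h2θ, h3θ⟩ := ((h1 F (h0 F)).and_eventually ((h2 F).and (h3 F))).exists
  have hend : EndpointExistence (Node00.datumOfRecord₁₃SepCoPH F 2 θ hP).C.toB12 := h2θ hP hU hθ hb hwin
  exact ⟨Node00.datumOfRecord₁₃SepCoPH F 2 θ hP, Node00.isDatumOfRecord₀_datumOfRecord₁₃SepCoPH F 2 θ hP, hb, hend,
    h3θ hP hU hθ hb hend⟩

/-! ### The dial is monotone in the regime -/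

variable {𝓛}
variable {𝓛₁ 𝓛₂ : (F : T4Family) → Filter (Node00.Stage13HParams F 2)}

/-- A finer regime asks LESS of node O. [folklore] -/
theorem k2L_of_le (hle : ∀ F, 𝓛₁ F ≤ 𝓛₂ F) (h : K2L 𝓛₂) : K2L 𝓛₁ := fun F => (h F).filter_mono (hle F)

/-- A finer regime asks LESS of the spine desk. [folklore] -/
theorem k3L_of_le (hle : ∀ F, 𝓛₁ F ≤ 𝓛₂ F) (h : K3L 𝓛₂) : K3L 𝓛₁ := fun F => (h F).filter_mono (hle F)

/-- A finer regime asks MORE of K1's family. [folklore] -/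
theorem k1L_of_le (hle : ∀ F, 𝓛₁ F ≤ 𝓛₂ F) (h : K1L 𝓛₁) : K1L 𝓛₂ := fun F hF => (h F hF).filter_mono (hle F)

/-- K1's lane proves EVENTUALLY along the regime for its parametric family; along a proper regime filter that is (more than) `K1L`. [folklore] -/
theorem k1L_of_eventually (hne : ∀ F, (𝓛 F).NeBot)
    (h : ∀ F : T4Family, Inhabited13 F → ∀ᶠ θ in 𝓛 F, ∃ hP : θ.Provisos₁₃SepCoPH F 2,
      (θ.ZhUnity F 2 ∧ θ.SlotsNondegenerate₁₃ F 2) ∧ θ.Admissible F 2 ∧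
      B16.EndStatementBPrinted (Node00.datumOfRecord₁₃SepCoPH F 2 θ hP).C ∧
      ∃ γ₁ : ℝ, 0 < γ₁ ∧ ∀ γ : ℝ, 0 < γ → γ ≤ γ₁ →
        ∃ P : B12.RunParams, 1 ≤ P.K ∧ ((Node00.datumOfRecord₁₃SepCoPH F 2 θ hP).C P).flow.InInterval γ P.K) : K1L 𝓛 :=
  fun F hF => haveI := hne F; (h F hF).frequently

/-! ### rev 25 (the ⁷ texts as filed) is the instance `𝓛 := ⊤` -/

/-- K2⁷ verbatim = node O's item at the TRIVIAL regime `⊤` («every admissible tuple»). [cite: Balaban1987RG1, Thm 2 p.259 (bookkeeping)] -/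
theorem k2L_top_iff : K2L (fun _ => ⊤) ↔ EndpointGivenBR13SepCoPH := by
  constructor
  · intro h F θ
    exact (eventually_top.mp (h F)) θ
  · intro h F
    exact eventually_top.mpr (h F)

/-- K1⁷ verbatim = K1's item at `⊤`. [cite: Balaban1989LargeFieldII, Thm 1 pp.355–356 (bookkeeping)] -/
theorem k1L_top_iff : K1L (fun _ => ⊤) ↔ StabilityBAtRecordR13SepCoPH := by
  constructor
  · intro h F hF
    exact frequently_top.mp (h F hF)
  · intro h F hF
    exact frequently_top.mpr (h F hF)

/-- K3⁷ verbatim = the spine item at `⊤`. [cite: Balaban1985UVStability3d, Thm 1 p.18 (bookkeeping)] -/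
theorem k3L_top_iff : K3L (fun _ => ⊤) ↔ SpineGivenEndpointR13SepCoPH := by
  constructor
  · intro h F θ
    exact (eventually_top.mp (h F)) θ
  · intro h F
    exact eventually_top.mpr (h F)

/-- Hence EVERY regime's node-O item is implied by K2⁷ as filed (`⊤` is the coarsest regime) … [folklore] -/
theorem k2L_of_k2_7 (h : EndpointGivenBR13SepCoPH) : K2L 𝓛 := k2L_of_le (fun _ => le_top) (k2L_top_iff.mpr h)

/-- … every regime's spine item by K3⁷ as filed … [folklore] -/
theorem k3L_of_k3_7 (h : SpineGivenEndpointR13SepCoPH) : K3L 𝓛 := k3L_of_le (fun _ => le_top) (k3L_top_iff.mpr h)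

/-- … and every regime's K1 item implies K1⁷ as filed. [folklore] -/
theorem k1_7_of_k1L (h : K1L 𝓛) : StabilityBAtRecordR13SepCoPH := k1L_top_iff.mp (k1L_of_le (fun _ => le_top) h)

end Seam

/-! ## §2 Director-ym №29's Variant R in plan g84's v7 vocabulary = the instance `𝓛 := 𝓟 {rows hold}`; there K2 is BORN CLOSED -/

section VariantR

/-- **node O's v7 rows at a tuple** = the consequents of plan g84's v7 PRECUT texts `OwnNumbersDriftPos` (2ᴼᴰ: a positive-slope drift of the own numbers
`bOwn k := β_{k+1}(0⃗)`) ∧ `RunChain190AtOwnDriftSlope` (1ᴼᴿ: given that drift, the run-wise (190)-chain relative to `bOwn` with side conditions, `0 < γ₀`, the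
cap against the slope and (C) on survivors) — verbatim bodies (drawer D84-K2V7 88baec82280b6909 :445 ∕ :458).
[cite: Balaban1987RG1, Thm 3 p.264, (2.12)–(2.14) p.268 and (5.10) p.293; Balaban1988RG2Cluster, Lemma 3 (2.38) p.20] -/
def Rows7 (F : T4Family) (θ : Node00.Stage13HParams F 2) (hP : θ.Provisos₁₃SepCoPH F 2) : Prop :=
  (∃ s A : ℝ, 0 < s ∧ OneLoopDrift s A (fun k => (Node00.datumOfRecord₁₃SepCoPH F 2 θ hP).βfun k (fun _ => 0))) ∧
  (∀ s A : ℝ, 0 < s → OneLoopDrift s A (fun k => (Node00.datumOfRecord₁₃SepCoPH F 2 θ hP).βfun k (fun _ => 0)) →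
    ∃ (M : ℕ) (_ : NeZero M) (μ ν : Fin 4) (c : B13.Consts) (ℓ α₂ : ℝ) (q : Consts190) (γ₀ : ℝ),
      (∀ (n : ℕ) (gs : ℕ → ℝ), RGEqH n (Node00.datumOfRecord₁₃SepCoPH F 2 θ hP).βfun gs → Step.InInterval γ₀ n gs → ∀ k, k ≤ n →
        ∃ a : LDom 4 → Pt 4 → ℝ, (Node00.datumOfRecord₁₃SepCoPH F 2 θ hP).βfun k (prefixOf gs k) -
            (Node00.datumOfRecord₁₃SepCoPH F 2 θ hP).βfun k (fun _ => 0) =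
          B12Beta.secondMoment (fun _ _ => limKernel a) μ ν ∧ Nonempty (PolLeavesTFac190H 4 M a c ℓ α₂ q)) ∧
      CondsL 4 c ℓ ∧ c.R22gen ℓ ∧ q.Valid c.δ₀ ∧ SignsL c α₂ q.B₃ ∧ 0 < γ₀ ∧
      c.ε₁ * remCoeffL 4 M c α₂ q.B₃ ≤ s ∧ SurvCont (Node00.datumOfRecord₁₃SepCoPH F 2 θ hP).βfun γ₀)

/-- **K1ᴿ⁷** — K1⁷'s body ∧ the rows at the SAME witness (№29: «K1's witness takes ε₂₉ ≤ ē; its lane owes the rows there»).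
[cite: Balaban1989LargeFieldII, Thm 1 pp.355–356; Balaban1987RG1, Thm 3 p.264] -/
def K1R7 : Prop :=
  ∀ F : T4Family, Inhabited13 F → ∃ (θ : Node00.Stage13HParams F 2) (hP : θ.Provisos₁₃SepCoPH F 2),
    (θ.ZhUnity F 2 ∧ θ.SlotsNondegenerate₁₃ F 2) ∧ θ.Admissible F 2 ∧
    B16.EndStatementBPrinted (Node00.datumOfRecord₁₃SepCoPH F 2 θ hP).C ∧
    (∃ γ₁ : ℝ, 0 < γ₁ ∧ ∀ γ : ℝ, 0 < γ → γ ≤ γ₁ →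
      ∃ P : B12.RunParams, 1 ≤ P.K ∧ ((Node00.datumOfRecord₁₃SepCoPH F 2 θ hP).C P).flow.InInterval γ P.K) ∧
    Rows7 F θ hP

/-- **K2ᴿ⁷** — K2⁷ with the rows DISPLAYED as a hypothesis. [cite: Balaban1987RG1, Thm 2 p.259 (first sentence), Thm 3 p.264] -/
def K2R7 : Prop :=
  ∀ (F : T4Family) (θ : Node00.Stage13HParams F 2) (hP : θ.Provisos₁₃SepCoPH F 2),
    (θ.ZhUnity F 2 ∧ θ.SlotsNondegenerate₁₃ F 2) → θ.Admissible F 2 →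
    B16.EndStatementBPrinted (Node00.datumOfRecord₁₃SepCoPH F 2 θ hP).C →
    (∃ γ₁ : ℝ, 0 < γ₁ ∧ ∀ γ : ℝ, 0 < γ → γ ≤ γ₁ →
      ∃ P : B12.RunParams, 1 ≤ P.K ∧ ((Node00.datumOfRecord₁₃SepCoPH F 2 θ hP).C P).flow.InInterval γ P.K) →
    Rows7 F θ hP → EndpointExistence (Node00.datumOfRecord₁₃SepCoPH F 2 θ hP).C.toB12

/-- **K2ᴿ⁷ IS BORN CLOSED** — in v7 vocabulary the displayed rows already give END by an4's one-text theorem p606097 (`endpointExistence_of_runLeaves190H_ownDrift` after two `obtain`s; = p609486's `endpointExistence_of_ownDrift_ownRunRows` by name once that module is built);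
unity ∕ admissibility ∕ (B) ∕ window unused.  CONDITIONAL bookkeeping, nothing of Bałaban asserted. [cite: Balaban1987RG1, Thm 2 p.259 (first sentence), Thm 3 p.264] -/
theorem k2R7_holds : K2R7 := by
  intro F θ hP _ _ _ _ hrows
  obtain ⟨⟨s, A, hs0, hdrift⟩, hR⟩ := hrows
  obtain ⟨M, instM, μ, ν, c, ℓ, α₂, q, γ₀, hrun, hC, h22, hq, hs, hγ₀, hcap, hcont⟩ := hR s A hs0 hdrift
  exact endpointExistence_of_runLeaves190H_ownDrift F θ hP hrun hC h22 hq hs hγ₀ hdrift hcap hcont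

/-- **What v7's pair becomes under the filter display**: node O's two texts keyed `𝓛`-EVENTUALLY (same bodies, `∀ᶠ θ in 𝓛 F` for `∀ θ`) supply `K2L 𝓛`
pointwise through `k2R7_holds`. [cite: Balaban1987RG1, Thm 2 p.259 (first sentence), Thm 3 p.264] -/
theorem k2L_of_eventually_rows7 {𝓛 : (F : T4Family) → Filter (Node00.Stage13HParams F 2)}
    (h : ∀ F : T4Family, ∀ᶠ θ in 𝓛 F, ∀ hP : θ.Provisos₁₃SepCoPH F 2,
      (θ.ZhUnity F 2 ∧ θ.SlotsNondegenerate₁₃ F 2) → θ.Admissible F 2 →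
      B16.EndStatementBPrinted (Node00.datumOfRecord₁₃SepCoPH F 2 θ hP).C →
      (∃ γ₁ : ℝ, 0 < γ₁ ∧ ∀ γ : ℝ, 0 < γ → γ ≤ γ₁ →
        ∃ P : B12.RunParams, 1 ≤ P.K ∧ ((Node00.datumOfRecord₁₃SepCoPH F 2 θ hP).C P).flow.InInterval γ P.K) →
      Rows7 F θ hP) : K2L 𝓛 :=
  fun F => (h F).mono fun θ hθ hP hU hA hb hwin => k2R7_holds F θ hP hU hA hb hwin (hθ hP hU hA hb hwin)

/-- `closes` under Variant R (v7 vocabulary), K3⁷ VERBATIM. [cite: Balaban1987RG1, Thm 2 p.259 (first sentence); Balaban1989LargeFieldII, Thm 1 pp.355–356 (bookkeeping)] -/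
theorem closesR7 (h0 : Record13SepCoPHInhabited) (h1 : K1R7) (h2 : K2R7) (h3 : SpineGivenEndpointR13SepCoPH) :
    Summit.QuantumFields.YangMills.Theses.BalabanLadder.UV := by
  intro F
  obtain ⟨θ, hP, hU, hθ, hb, hwin, hrows⟩ := h1 F (h0 F)
  have hend : EndpointExistence (Node00.datumOfRecord₁₃SepCoPH F 2 θ hP).C.toB12 := h2 F θ hP hU hθ hb hwin hrows
  exact ⟨Node00.datumOfRecord₁₃SepCoPH F 2 θ hP, Node00.isDatumOfRecord₀_datumOfRecord₁₃SepCoPH F 2 θ hP, hb, hend, h3 F θ hP hU hθ hb hend⟩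

/-- … so under R in v7 vocabulary the route's LOAD-BEARING cone is THREE items: K0⁷, K1ᴿ⁷, K3⁷ (K2ᴿ⁷ discharged by name — BC7 `crux.in-tree`: a support, not a crux).
[cite: Balaban1987RG1, Thm 2 p.259 (bookkeeping)] -/
theorem closesR7_cone3 (h0 : Record13SepCoPHInhabited) (h1 : K1R7) (h3 : SpineGivenEndpointR13SepCoPH) :
    Summit.QuantumFields.YangMills.Theses.BalabanLadder.UV :=
  closesR7 h0 h1 k2R7_holds h3

/-- K1ᴿ⁷ ⟹ K1⁷ (drop the rows). [folklore] -/
theorem k1_7_of_k1R7 (h : K1R7) : StabilityBAtRecordR13SepCoPH := by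
  intro F hF
  obtain ⟨θ, hP, hU, hθ, hb, hwin, _⟩ := h F hF
  exact ⟨θ, hP, hU, hθ, hb, hwin⟩

/-- K1⁷ ∧ v7's two stubs proved ∀θ ⟹ K1ᴿ⁷: the ∀θ pair is a SUFFICIENT (and, per the g10 finding, over-strong) supplier of R's new K1 conjunct;
the faithful supplier is «rows at K1's own family», internal to K1's lane. [folklore] -/
theorem k1R7_of_k1_7_of_rows7 (h1 : StabilityBAtRecordR13SepCoPH)
    (hrows : ∀ (F : T4Family) (θ : Node00.Stage13HParams F 2) (hP : θ.Provisos₁₃SepCoPH F 2),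
      (θ.ZhUnity F 2 ∧ θ.SlotsNondegenerate₁₃ F 2) → θ.Admissible F 2 →
      B16.EndStatementBPrinted (Node00.datumOfRecord₁₃SepCoPH F 2 θ hP).C →
      (∃ γ₁ : ℝ, 0 < γ₁ ∧ ∀ γ : ℝ, 0 < γ → γ ≤ γ₁ →
        ∃ P : B12.RunParams, 1 ≤ P.K ∧ ((Node00.datumOfRecord₁₃SepCoPH F 2 θ hP).C P).flow.InInterval γ P.K) →
      Rows7 F θ hP) : K1R7 := by
  intro F hF
  obtain ⟨θ, hP, hU, hθ, hb, hwin⟩ := h1 F hF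
  exact ⟨θ, hP, hU, hθ, hb, hwin, hrows F θ hP hU hθ hb hwin⟩

/-- **The rows regime**: the PRINCIPAL filter of the set of tuples at which node O's v7 rows hold (under every proviso proof — proof-irrelevant).
[cite: Balaban1987RG1, Thm 3 p.264 (bookkeeping)] -/
def rowsRegime (F : T4Family) : Filter (Node00.Stage13HParams F 2) :=
  𝓟 {θ | ∀ hP : θ.Provisos₁₃SepCoPH F 2, Rows7 F θ hP}

/-- **Variant R = the seam filter at the rows regime, node O's side**: `K2L rowsRegime ↔ K2ᴿ⁷`. [folklore] -/
theorem k2L_rows_iff : K2L rowsRegime ↔ K2R7 := by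
  constructor
  · intro h F θ hP hU hθ hb hwin hrows
    exact (eventually_principal.mp (h F)) θ (fun _ => hrows) hP hU hθ hb hwin
  · intro h F
    exact eventually_principal.mpr fun θ hθ hP hU hθ' hb hwin => h F θ hP hU hθ' hb hwin (hθ hP)

/-- **Variant R = the seam filter at the rows regime, K1's side**: `K1L rowsRegime ↔ K1ᴿ⁷`. [folklore] -/
theorem k1L_rows_iff : K1L rowsRegime ↔ K1R7 := by
  constructor
  · intro h F hF
    obtain ⟨θ, hθ, hP, hU, hθ', hb, hwin⟩ := frequently_principal.mp (h F hF)
    exact ⟨θ, hP, hU, hθ', hb, hwin, hθ hP⟩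
  · intro h F hF
    obtain ⟨θ, hP, hU, hθ', hb, hwin, hrows⟩ := h F hF
    exact frequently_principal.mpr ⟨θ, fun _ => hrows, hP, hU, hθ', hb, hwin⟩

/-- At the rows regime node O's filter item is a THEOREM (born closed). [cite: Balaban1987RG1, Thm 2 p.259 (bookkeeping)] -/
theorem k2L_rows_holds : K2L rowsRegime := k2L_rows_iff.mpr k2R7_holds

end VariantR

/-! ## §3 Variant T, the seam game S′ and print's order of constants as instances -/

section Instances

/-- **Variant T's regime** (drawer D82-REV26 `K2T := ∀ F, ∃ ε > 0, ∀ θ …, θ.ε₂₉ ≤ ε → …`): the (2.9) threshold tends to `0⁺` UNIFORMLY in every other letter.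
[cite: Balaban1987RG1, (2.9) p.266, Thm 3 p.264] -/
def byEps29Uniform (F : T4Family) : Filter (Node00.Stage13HParams F 2) :=
  Filter.comap (fun θ : Node00.Stage13HParams F 2 => θ.ε₂₉) (𝓝[>] (0 : ℝ))

/-- The ε₂₉-ray through a tuple: `θ₀` with its (2.9) threshold replaced (every other letter frozen). [cite: Balaban1987RG1, (2.9) p.266 (bookkeeping)] -/
def setEps29 {F : T4Family} (θ₀ : Node00.Stage13HParams F 2) (e : ℝ) : Node00.Stage13HParams F 2 :=
  { θ₀ with ε₂₉ := e }

/-- The replaced threshold is the one read back. [folklore] -/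
theorem eps29_setEps29 {F : T4Family} (θ₀ : Node00.Stage13HParams F 2) (e : ℝ) : (setEps29 θ₀ e).ε₂₉ = e := rfl

/-- **The seam game S′'s regime**: ε₂₉ → 0⁺ along every frozen class (the threshold node O needs MAY depend on the other letters of the class).
[cite: Balaban1987RG1, (2.9) p.266, Thm 3 p.264] -/
def byEps29Frozen (F : T4Family) : Filter (Node00.Stage13HParams F 2) :=
  ⨆ θ₀ : Node00.Stage13HParams F 2, Filter.map (setEps29 θ₀) (𝓝[>] (0 : ℝ))

/-- S′'s node-O item UNFOLDED: for every frozen class, for all sufficiently small ε₂₉, K2⁷'s body at `θ₀[ε₂₉ := e]`. [cite: Balaban1987RG1, Thm 3 p.264 (bookkeeping)] -/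
theorem k2L_byEps29Frozen_iff : K2L byEps29Frozen ↔
    ∀ (F : T4Family) (θ₀ : Node00.Stage13HParams F 2), ∀ᶠ e in 𝓝[>] (0 : ℝ), ∀ hP : (setEps29 θ₀ e).Provisos₁₃SepCoPH F 2,
      ((setEps29 θ₀ e).ZhUnity F 2 ∧ (setEps29 θ₀ e).SlotsNondegenerate₁₃ F 2) → (setEps29 θ₀ e).Admissible F 2 →
      B16.EndStatementBPrinted (Node00.datumOfRecord₁₃SepCoPH F 2 (setEps29 θ₀ e) hP).C →
      (∃ γ₁ : ℝ, 0 < γ₁ ∧ ∀ γ : ℝ, 0 < γ → γ ≤ γ₁ →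
        ∃ P : B12.RunParams, 1 ≤ P.K ∧ ((Node00.datumOfRecord₁₃SepCoPH F 2 (setEps29 θ₀ e) hP).C P).flow.InInterval γ P.K) →
      EndpointExistence (Node00.datumOfRecord₁₃SepCoPH F 2 (setEps29 θ₀ e) hP).C.toB12 := by
  simp only [K2L, byEps29Frozen, eventually_iSup, eventually_map]

/-- S′'s K1 item UNFOLDED: some frozen class along which K1's conjuncts hold for ε₂₉ FREQUENTLY near `0⁺` (a family parametric in ε₂₉ gives eventually, hence this).
[cite: Balaban1989LargeFieldII, Thm 1 pp.355–356 (bookkeeping)] -/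
theorem k1L_byEps29Frozen_iff : K1L byEps29Frozen ↔
    ∀ F : T4Family, Inhabited13 F → ∃ θ₀ : Node00.Stage13HParams F 2, ∃ᶠ e in 𝓝[>] (0 : ℝ),
      ∃ hP : (setEps29 θ₀ e).Provisos₁₃SepCoPH F 2,
      ((setEps29 θ₀ e).ZhUnity F 2 ∧ (setEps29 θ₀ e).SlotsNondegenerate₁₃ F 2) ∧ (setEps29 θ₀ e).Admissible F 2 ∧
      B16.EndStatementBPrinted (Node00.datumOfRecord₁₃SepCoPH F 2 (setEps29 θ₀ e) hP).C ∧
      ∃ γ₁ : ℝ, 0 < γ₁ ∧ ∀ γ : ℝ, 0 < γ → γ ≤ γ₁ →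
        ∃ P : B12.RunParams, 1 ≤ P.K ∧ ((Node00.datumOfRecord₁₃SepCoPH F 2 (setEps29 θ₀ e) hP).C P).flow.InInterval γ P.K := by
  simp only [K1L, byEps29Frozen, frequently_iSup, frequently_map]

/-- The frozen-class regime is FINER than Variant T's uniform one (so `K2L byEps29Uniform → K2L byEps29Frozen` by `k2L_of_le`: T asks more of node O than S′).
[folklore] -/
theorem byEps29Frozen_le_uniform (F : T4Family) : byEps29Frozen F ≤ byEps29Uniform F := by
  refine iSup_le fun θ₀ => ?_
  rw [byEps29Uniform, Filter.map_le_iff_le_comap, Filter.comap_comap]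
  have hid : ((fun θ : Node00.Stage13HParams F 2 => θ.ε₂₉) ∘ setEps29 θ₀) = id := funext fun e => rfl
  rw [hid, Filter.comap_id]

/-- Variant T asks at least as much of node O as S′. [folklore] -/
theorem k2L_frozen_of_uniform (h : K2L byEps29Uniform) : K2L byEps29Frozen :=
  k2L_of_le byEps29Frozen_le_uniform h

variable (set2 : (F : T4Family) → Node00.Stage13HParams F 2 → ℝ × ℝ → Node00.Stage13HParams F 2)

/-- **Print's ORDER OF CONSTANTS as a regime (two-letter model)**: through any letters-setter `set2 F θ₀ (e, g)` («first letter `e`, then `g`»), the iterated filter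
`(𝓝[>] 0).curry (𝓝[>] 0)` — «`e` sufficiently small, then `g` sufficiently small GIVEN `e`» — along every frozen class.  More letters = a longer curry chain
(`atTop` for `κ`, `M`; `𝓝[>] 0` for `ε₀`, `ε₁ = ε₂₉`, `α₀`, `α₁`, `γ`), in print's order. [cite: Balaban1987RG1, Thm 3 p.264; Balaban1985Variational, Thm 1 (order of the constants)] -/
def bySeam2 (F : T4Family) : Filter (Node00.Stage13HParams F 2) :=
  ⨆ θ₀ : Node00.Stage13HParams F 2, Filter.map (set2 F θ₀) ((𝓝[>] (0 : ℝ)).curry (𝓝[>] (0 : ℝ)))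

/-- The two-letter node-O item UNFOLDED: «∀ class, ∀ᶠ e → 0⁺, ∀ᶠ g → 0⁺ (threshold depending on e), K2⁷'s body at `set2 θ₀ (e, g)`» — [I] Thm 3's quantifier shape.
[cite: Balaban1987RG1, Thm 3 p.264 (bookkeeping)] -/
theorem k2L_bySeam2_iff : K2L (bySeam2 set2) ↔
    ∀ (F : T4Family) (θ₀ : Node00.Stage13HParams F 2), ∀ᶠ e in 𝓝[>] (0 : ℝ), ∀ᶠ g in 𝓝[>] (0 : ℝ),
      ∀ hP : (set2 F θ₀ (e, g)).Provisos₁₃SepCoPH F 2,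
      ((set2 F θ₀ (e, g)).ZhUnity F 2 ∧ (set2 F θ₀ (e, g)).SlotsNondegenerate₁₃ F 2) → (set2 F θ₀ (e, g)).Admissible F 2 →
      B16.EndStatementBPrinted (Node00.datumOfRecord₁₃SepCoPH F 2 (set2 F θ₀ (e, g)) hP).C →
      (∃ γ₁ : ℝ, 0 < γ₁ ∧ ∀ γ : ℝ, 0 < γ → γ ≤ γ₁ →
        ∃ P : B12.RunParams, 1 ≤ P.K ∧ ((Node00.datumOfRecord₁₃SepCoPH F 2 (set2 F θ₀ (e, g)) hP).C P).flow.InInterval γ P.K) →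
      EndpointExistence (Node00.datumOfRecord₁₃SepCoPH F 2 (set2 F θ₀ (e, g)) hP).C.toB12 := by
  simp only [K2L, bySeam2, eventually_iSup, eventually_map, eventually_curry_iff]

/-- A concrete two-letter setter on the record: `(ε₂₉, γ) := (e, g)`, everything else frozen («ε₁ first, then γ ≤ γ̄(ε₁)», [I] Thm 3 p.264).
[cite: Balaban1987RG1, (2.9) p.266, Thm 3 p.264 (bookkeeping)] -/
def setEps29Gamma (F : T4Family) (θ₀ : Node00.Stage13HParams F 2) (p : ℝ × ℝ) : Node00.Stage13HParams F 2 :=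
  { θ₀ with ε₂₉ := p.1, γ := p.2 }

/-- The two letters read back. [folklore] -/
theorem letters_setEps29Gamma (F : T4Family) (θ₀ : Node00.Stage13HParams F 2) (p : ℝ × ℝ) :
    ((setEps29Gamma F θ₀ p).ε₂₉, (setEps29Gamma F θ₀ p).γ) = p := rfl

end Instances

end Summit.QuantumFields.YangMills.Cruxes.EndpointGivenBR13SepCoPH.Idea4g11
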